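import Literature.AnabelianGeometry.AbsoluteAnabelian.AbsTopIII.CurveModelSchemaWitnesses
import Literature.AnabelianGeometry.AbsoluteAnabelian.AbsTopIII.CuspidalCyclotomeKummerUnitsClosureRefutations
import Literature.AnabelianGeometry.AbsoluteAnabelian.AbsTopIII.KummerFaithfulPadicConsequences
import HarnessLib

/-!
# [AbsTopIII] Prop. 1.6 (iii), Prop. 1.8 (i), (ii) for Kummer classes of regular units, relative to a
# `KummerCurveModel` (FACT-LIST F-0343 / F-0344 / F-0345): INSTANCE FORMS at the tree's NAMED toy carriers

S. Mochizuki, *Topics in Absolute Anabelian Geometry III: Global Reconstruction Algorithms* [AbsTopIII]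
(bib `MochizukiAbsTopIII2015`; kurims manuscript `paper:url-5493eb38cbb7`), §1, Prop. 1.6 (iii) p. 35
("`1 → (k^×)^∧ → H¹(Π_U, M_X) → ⊕_{x ∈ S} Ẑ`"), Prop. 1.8 (i), (ii) p. 36 (characterisation of
nonconstant NF-rational functions / NF-constants by restricting Kummer classes to decomposition groups of
NF-points; printed proof p. 36 l. 42–50).

PROOF-ONLY companion (cell abc-iut, block F, seat abc-iut-f-071 gen 5, KEY row «INST59G1»; no `def`, no
`instance`, no notation, no new named fact) of abc-iut-L4-t1's `CuspidalCyclotome.lean` (imported, never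
edited).  CONTEXT.  `Prop_1_6_iii_units M`, `Prop_1_8_i_units M`, `Prop_1_8_ii_units M` are NAMED FACTS
RELATIVE TO an interface `M : KummerCurveModel` (a `CurveModel` plus FREE Kummer data: regular units
`Γ(U, 𝒪_U^×) ≤ K_U^×` and a Kummer map `κ_U : Γ(U, 𝒪_U^×) → H¹(Π_U, M_X)`).  Their universal closures are
REFUTED in the tree (`not_forall_prop_1_6_iii_units`, `not_forall_prop_1_8_i_units`,
`not_forall_prop_1_8_ii_units`, abc-iut-f-078 / f-085: the junk model `KummerUnitsClosureWitness.model ℚ_2`),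
and the only kernel-visible instances so far were the empty-curve ones (`…_of_isEmpty_curve`, binder type
uninhabited).  This file records INSTANCE FORMS — theorems whose conclusion IS the row's declaration
applied to a NAMED interface of the tree — with INHABITED binders:

* `prop_1_6_iii_units_toyKummerModel k` (F-0343) and `prop_1_8_i_units_toyKummerModel k` (F-0344) at
  abc-iut-f-077's `CurveModelSchemaWitness.toyKummerModel k` (one curve over `k`, `Π := G_k × Ẑ ↠ G_k`,
  one rational cusp with `I = Δ ≅ Ẑ` — a cyclotome presentation —, `K_U := k`, `Γ(U, 𝒪_U^×) := k^×`,
  `κ_U := 1`): **every hypothesis binder fires** at `k = ℚ` / `k = ℚ_p` (`…_rat_binders`,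
  `…_padic_binders`: cofinite opens, scheme flag, the cyclotome presentation
  `isCyclotomePresentation_toyModel_zHat`, `IsKummerFaithful ℚ` / `IsKummerFaithful ℚ_p` by
  `isKummerFaithful_rat` / `isKummerFaithful_padic`, all cusps rational, `IsNFCurve`, and the unit binder
  `f` ranges over the non-trivial group `k^×`);
* `prop_1_8_ii_units_toyKummerModel k` (F-0345) at the same carrier — DEGENERATE: the premise "there is a
  nonconstant NF-rational regular unit" never fires there (`K_U = k`), recorded next to the instance
  (`not_exists_nonconstant_unit_toyKummerModel`);
* the EXACT STATUS of the three rows at abc-iut-f-078's junk carrier `KummerUnitsClosureWitness.model k`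
  (`K_U := k(X)`, all units regular, `κ_U := 1`, `IsNFConstant := False`): each row holds there IFF the base
  field is NOT Kummer-faithful (`…_kummerUnitsModel_iff_not_isKummerFaithful`; `→` is f-078's refutation,
  `←` is vacuity in the Kummer-faithfulness binder) — so at `k = ℚ`, `ℚ_p` all three FAIL there.

HONEST LABEL — DEGENERATE IN THE FUNCTION-FIELD DATUM: `toyKummerModel k` declares `K_U := k`, so every
regular unit is a constant and the Kummer map is trivial; at this carrier Prop. 1.6 (iii) holds because BOTH
sides of its equivalence hold for every unit, and Prop. 1.8 (i) because BOTH sides fail for every unit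
(no nonconstant function; `κ_U(f) = 0` has no non-zero restriction).  The printed content (cuspidal
restrictions DETECT nonconstant functions; value-surjectivity `X_NF(k̄_NF) ↠ ℙ¹(k̄_NF)`) is absent: an
instance form about OUR typed statement ≠ the printed theorem.  WHY NO NON-DEGENERATE NAMED INSTANCE: a
carrier with a nonconstant regular unit `g` satisfying F-0343 needs a cusp `c` with `κ_U(g)|_{I_c} ≠ 0`,
i.e. a NON-ZERO class in Mathlib's `continuousCohomology 1` of the conjugation representation on
`geomCyclotome` together with a non-vanishing restriction — the genuine étale-`π₁` Kummer map of a
hyperbolic curve over a Kummer-faithful field ([AbsTopIII] Def. 1.5, [Mzk19] §2), which the tree does not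
construct at any named `def` (carrier census: `KummerProp16iOfKummerLawsNV.lean`).  Refereed results typed
statements-first (D-0014); typed ≠ proved; refuted-as-typed ≠ refuted-in-print; nothing here bears on
[IUTchIII] Cor. 3.12 or asserts that abc is proved or refuted; no side taken.  Axioms standard.
-/

noncomputable section

namespace Literature.AnabelianGeometry.AbsoluteAnabelian.AbsTopIII

open CurveModelSchemaWitness

/-! ### The toy Kummer carrier `toyKummerModel k`: trivial Kummer classes, constant units -/

/-- At `toyKummerModel k` every Kummer class is `0` (`κ_U := 1`).
[cite: MochizukiAbsTopIII2015, Prop 1.6 p.34] -/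
theorem toAdd_kummer_toyKummerModel (k : Type) [Field k] [CharZero k]
    {U Ux X : (toyKummerModel k).Curve} (h₁ : (toyKummerModel k).IsCofiniteOpen U Ux)
    (h₂ : (toyKummerModel k).IsCofiniteOpen Ux X) (f : (toyKummerModel k).regularUnits U) :
    Multiplicative.toAdd ((toyKummerModel k).kummer h₁ h₂ f) = 0 :=
  rfl

/-- At `toyKummerModel k` every regular unit is a constant (`K_U := k`).
[cite: MochizukiAbsTopIII2015, Prop 1.6 (iii) p.35] -/
theorem unit_mem_range_toyKummerModel (k : Type) [Field k] [CharZero k]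
    {U : (toyKummerModel k).Curve} (f : (toyKummerModel k).regularUnits U) :
    (((f : ((toyKummerModel k).FunctionField U)ˣ)) : (toyKummerModel k).FunctionField U)
      ∈ Set.range (algebraMap ((toyKummerModel k).base U) ((toyKummerModel k).FunctionField U)) :=
  ⟨((f : kˣ) : k), rfl⟩

/-- Hence the premise of Prop. 1.8 (ii) — "there exist nonconstant NF-rational functions
`∈ Γ(U, 𝒪_U^×)`" — NEVER fires at `toyKummerModel k` (the source of the degeneracy of F-0345 there).
[cite: MochizukiAbsTopIII2015, Prop 1.8 (ii) p.36] -/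
theorem not_exists_nonconstant_unit_toyKummerModel (k : Type) [Field k] [CharZero k]
    (U : (toyKummerModel k).Curve) :
    ¬ ∃ g : (toyKummerModel k).regularUnits U,
      (toyKummerModel k).IsNFRational U
          (((g : ((toyKummerModel k).FunctionField U)ˣ)) : (toyKummerModel k).FunctionField U) ∧
        (((g : ((toyKummerModel k).FunctionField U)ˣ)) : (toyKummerModel k).FunctionField U)
          ∉ Set.range (algebraMap ((toyKummerModel k).base U) ((toyKummerModel k).FunctionField U)) :=
  fun ⟨g, _, hg⟩ => hg (unit_mem_range_toyKummerModel k g)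

/-! ### F-0343 `Prop_1_6_iii_units` at `toyKummerModel k` -/

/-- **F-0343, instance form at the toy Kummer carrier** (DEGENERATE in the function-field datum `K_U := k`:
both sides of the displayed equivalence hold for every unit — all restrictions of `κ_U(f) = 0` vanish, and
`f` is a constant). [cite: MochizukiAbsTopIII2015, Prop 1.6 (iii) p.35] -/
theorem prop_1_6_iii_units_toyKummerModel (k : Type) [Field k] [CharZero k] :
    Prop_1_6_iii_units (toyKummerModel k) := by
  intro U Ux X h₁ h₂ x _ _ _ _ f
  refine ⟨fun _ => unit_mem_range_toyKummerModel k f, fun _ c => ?_⟩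
  rw [toAdd_kummer_toyKummerModel]
  exact KummerUnitsClosureWitness.geomCyclotomeH1Res_zero _ _ _

/-- **F-0343 over `ℚ` (closed instance).** [cite: MochizukiAbsTopIII2015, Prop 1.6 (iii) p.35] -/
theorem prop_1_6_iii_units_toyKummerModel_rat : Prop_1_6_iii_units (toyKummerModel ℚ) :=
  prop_1_6_iii_units_toyKummerModel ℚ

/-- **F-0343 over `ℚ_p` (closed instance).** [cite: MochizukiAbsTopIII2015, Prop 1.6 (iii) p.35] -/
theorem prop_1_6_iii_units_toyKummerModel_padic (p : ℕ) [Fact p.Prime] :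
    Prop_1_6_iii_units (toyKummerModel ℚ_[p]) :=
  prop_1_6_iii_units_toyKummerModel ℚ_[p]

/-! ### F-0344 `Prop_1_8_i_units` at `toyKummerModel k` -/

/-- **F-0344, instance form at the toy Kummer carrier** (DEGENERATE in the function-field datum `K_U := k`:
both sides of the displayed equivalence FAIL for every unit — no unit is nonconstant, and no positive
multiple of `κ_U(f) = 0` has a non-zero restriction). [cite: MochizukiAbsTopIII2015, Prop 1.8 (i) p.36] -/
theorem prop_1_8_i_units_toyKummerModel (k : Type) [Field k] [CharZero k] :
    Prop_1_8_i_units (toyKummerModel k) := by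
  intro U Ux X h₁ h₂ x _ _ _ _ _ f
  refine ⟨fun hf => absurd (unit_mem_range_toyKummerModel k f) hf.2, ?_⟩
  rintro ⟨n, -, x₁, x₂, -, -, -, hne⟩
  refine absurd ?_ hne
  rw [toAdd_kummer_toyKummerModel, smul_zero]
  exact KummerUnitsClosureWitness.geomCyclotomeH1Res_zero _ _ _

/-- **F-0344 over `ℚ` (closed instance).** [cite: MochizukiAbsTopIII2015, Prop 1.8 (i) p.36] -/
theorem prop_1_8_i_units_toyKummerModel_rat : Prop_1_8_i_units (toyKummerModel ℚ) :=
  prop_1_8_i_units_toyKummerModel ℚ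

/-- **F-0344 over `ℚ_p` (closed instance).** [cite: MochizukiAbsTopIII2015, Prop 1.8 (i) p.36] -/
theorem prop_1_8_i_units_toyKummerModel_padic (p : ℕ) [Fact p.Prime] :
    Prop_1_8_i_units (toyKummerModel ℚ_[p]) :=
  prop_1_8_i_units_toyKummerModel ℚ_[p]

/-! ### F-0345 `Prop_1_8_ii_units` at `toyKummerModel k` (premise-degenerate) -/

/-- **F-0345, instance form at the toy Kummer carrier — DEGENERATE**: the premise "there exist nonconstant
NF-rational regular units" of Prop. 1.8 (ii) never fires at `toyKummerModel k` (`K_U := k`,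
`not_exists_nonconstant_unit_toyKummerModel`), so the row holds there with no content.
[cite: MochizukiAbsTopIII2015, Prop 1.8 (ii) p.36] -/
theorem prop_1_8_ii_units_toyKummerModel (k : Type) [Field k] [CharZero k] :
    Prop_1_8_ii_units (toyKummerModel k) :=
  fun U _ _ _ _ _ _ _ _ _ _ hg => absurd hg (not_exists_nonconstant_unit_toyKummerModel k U)

/-- **F-0345 over `ℚ` (closed instance, premise-degenerate).** [cite: MochizukiAbsTopIII2015, Prop 1.8 (ii) p.36] -/
theorem prop_1_8_ii_units_toyKummerModel_rat : Prop_1_8_ii_units (toyKummerModel ℚ) :=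
  prop_1_8_ii_units_toyKummerModel ℚ

/-! ### The binders that DO fire at `toyKummerModel ℚ` / `toyKummerModel ℚ_p` -/

/-- **Every hypothesis binder of F-0343 / F-0344 fires at `toyKummerModel ℚ`**: for all curves `U, U_x, X`
of the carrier (there is one) and every cusp `x` (there is one): `U ⊆ U_x ⊆ X` are cofinite opens, `U` is
scheme-like, `(U_x ⊆ X, x)` IS a cyclotome presentation (`I_x = Δ ≅ Ẑ`, abc-iut-f-077), the base field `ℚ`
IS Kummer-faithful (`isKummerFaithful_rat`, abc-iut-f-085), every cusp of `U` is rational, `U` is flagged an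
NF-curve, and the unit binder ranges over a non-trivial group (`k^× ∋ 2 ≠ 1`).  Only the function-field
datum `K_U := ℚ` is degenerate. [cite: MochizukiAbsTopIII2015, Prop 1.6 (iii) p.35] -/
theorem toyKummerModel_rat_binders :
    ∀ (U Ux X : (toyKummerModel ℚ).Curve) (x : ((toyKummerModel ℚ).cusps Ux).Cusp),
      (toyKummerModel ℚ).IsCofiniteOpen U Ux ∧ (toyKummerModel ℚ).IsCofiniteOpen Ux X ∧
        (toyKummerModel ℚ).IsScheme U ∧
        (toyKummerModel ℚ).IsCyclotomePresentation (Ux := Ux) (X := X) trivial x ∧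
        IsKummerFaithful ((toyKummerModel ℚ).base U) ∧
        (∀ c : ((toyKummerModel ℚ).cusps U).Cusp, ((toyKummerModel ℚ).cusps U).IsRational c) ∧
        (toyKummerModel ℚ).IsNFCurve U ∧
        ∃ f g : (toyKummerModel ℚ).regularUnits U, f ≠ g :=
  fun _ _ _ x => ⟨trivial, trivial, trivial, isCyclotomePresentation_toyModel_zHat ℚ x,
    isKummerFaithful_rat, fun c => isRational_topCusps _ c, trivial,
    ⟨1, ⟨Units.mk0 (2 : ℚ) two_ne_zero, Subgroup.mem_top _⟩, fun h => by
      have h' := congrArg (fun u : (⊤ : Subgroup ℚˣ) => ((u : ℚˣ) : ℚ)) h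
      norm_num at h'⟩⟩

/-- **Every hypothesis binder of F-0343 / F-0344 fires at `toyKummerModel ℚ_p`** (`IsKummerFaithful ℚ_p` by
`isKummerFaithful_padic`). [cite: MochizukiAbsTopIII2015, Prop 1.6 (iii) p.35] -/
theorem toyKummerModel_padic_binders (p : ℕ) [Fact p.Prime] :
    ∀ (U Ux X : (toyKummerModel ℚ_[p]).Curve) (x : ((toyKummerModel ℚ_[p]).cusps Ux).Cusp),
      (toyKummerModel ℚ_[p]).IsCofiniteOpen U Ux ∧ (toyKummerModel ℚ_[p]).IsCofiniteOpen Ux X ∧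
        (toyKummerModel ℚ_[p]).IsScheme U ∧
        (toyKummerModel ℚ_[p]).IsCyclotomePresentation (Ux := Ux) (X := X) trivial x ∧
        IsKummerFaithful ((toyKummerModel ℚ_[p]).base U) ∧
        (∀ c : ((toyKummerModel ℚ_[p]).cusps U).Cusp, ((toyKummerModel ℚ_[p]).cusps U).IsRational c) ∧
        (toyKummerModel ℚ_[p]).IsNFCurve U :=
  fun _ _ _ x => ⟨trivial, trivial, trivial, isCyclotomePresentation_toyModel_zHat ℚ_[p] x,
    isKummerFaithful_padic p, fun c => isRational_topCusps _ c, trivial⟩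

/-- **F-0343 and F-0344 at `toyKummerModel ℚ`, instance forms next to their firing binders** (one term).
[cite: MochizukiAbsTopIII2015, Prop 1.8 (i) p.36] -/
theorem prop_1_6_iii_units_and_prop_1_8_i_units_toyKummerModel_rat :
    Prop_1_6_iii_units (toyKummerModel ℚ) ∧ Prop_1_8_i_units (toyKummerModel ℚ) ∧
      ∀ (U Ux X : (toyKummerModel ℚ).Curve) (x : ((toyKummerModel ℚ).cusps Ux).Cusp),
        (toyKummerModel ℚ).IsCyclotomePresentation (Ux := Ux) (X := X) trivial x ∧
          IsKummerFaithful ((toyKummerModel ℚ).base U) :=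
  ⟨prop_1_6_iii_units_toyKummerModel ℚ, prop_1_8_i_units_toyKummerModel ℚ,
    fun U Ux X x => ⟨(toyKummerModel_rat_binders U Ux X x).2.2.2.1, isKummerFaithful_rat⟩⟩

/-! ### Exact status at the junk carrier `KummerUnitsClosureWitness.model k` -/

/-- **F-0343 at abc-iut-f-078's junk carrier holds IFF the base field is NOT Kummer-faithful**: `→` is
f-078's refutation `KummerUnitsClosureWitness.not_prop_1_6_iii_units` (the nonconstant unit `X ∈ k(X)^×`
with `κ_U(X) = 0`), `←` is vacuity in the Kummer-faithfulness binder.  In particular the row FAILS there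
over `ℚ` and `ℚ_p`. [cite: MochizukiAbsTopIII2015, Prop 1.6 (iii) p.35] -/
theorem prop_1_6_iii_units_kummerUnitsModel_iff_not_isKummerFaithful (k : Type) [Field k] [CharZero k] :
    Prop_1_6_iii_units (KummerUnitsClosureWitness.model k) ↔ ¬ IsKummerFaithful k :=
  ⟨fun h hk => KummerUnitsClosureWitness.not_prop_1_6_iii_units hk h,
    fun hk _ _ _ _ _ _ _ _ hKF => absurd hKF hk⟩

/-- **F-0344 at the junk carrier holds IFF the base field is NOT Kummer-faithful.**
[cite: MochizukiAbsTopIII2015, Prop 1.8 (i) p.36] -/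
theorem prop_1_8_i_units_kummerUnitsModel_iff_not_isKummerFaithful (k : Type) [Field k] [CharZero k] :
    Prop_1_8_i_units (KummerUnitsClosureWitness.model k) ↔ ¬ IsKummerFaithful k :=
  ⟨fun h hk => KummerUnitsClosureWitness.not_prop_1_8_i_units hk h,
    fun hk _ _ _ _ _ _ _ _ hKF => absurd hKF hk⟩

/-- **F-0345 at the junk carrier holds IFF the base field is NOT Kummer-faithful.**
[cite: MochizukiAbsTopIII2015, Prop 1.8 (ii) p.36] -/
theorem prop_1_8_ii_units_kummerUnitsModel_iff_not_isKummerFaithful (k : Type) [Field k] [CharZero k] :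
    Prop_1_8_ii_units (KummerUnitsClosureWitness.model k) ↔ ¬ IsKummerFaithful k :=
  ⟨fun h hk => KummerUnitsClosureWitness.not_prop_1_8_ii_units hk h,
    fun hk _ _ _ _ _ _ _ _ hKF => absurd hKF hk⟩

/-- Hence all three rows FAIL at the junk carrier over `ℚ` (`isKummerFaithful_rat`): the junk carrier is a
counter-model, the toy Kummer carrier a (degenerate) model — the rows are SCHEMAS, decided per instance.
[cite: MochizukiAbsTopIII2015, Prop 1.8 p.36] -/
theorem not_props_kummerUnitsModel_rat :
    ¬ Prop_1_6_iii_units (KummerUnitsClosureWitness.model ℚ) ∧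
      ¬ Prop_1_8_i_units (KummerUnitsClosureWitness.model ℚ) ∧
        ¬ Prop_1_8_ii_units (KummerUnitsClosureWitness.model ℚ) :=
  ⟨fun h => (prop_1_6_iii_units_kummerUnitsModel_iff_not_isKummerFaithful ℚ).mp h isKummerFaithful_rat,
    fun h => (prop_1_8_i_units_kummerUnitsModel_iff_not_isKummerFaithful ℚ).mp h isKummerFaithful_rat,
    fun h => (prop_1_8_ii_units_kummerUnitsModel_iff_not_isKummerFaithful ℚ).mp h isKummerFaithful_rat⟩

end Literature.AnabelianGeometry.AbsoluteAnabelian.AbsTopIII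

end
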